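import Mathlib
import HarnessLib

/-!
# The Kummer element of the aux-norm line is not a `p`-th power in `K`

Helper file for crux `stmt-BirchSwinnertonDyer-19715`, line `aux_norm_receptacle`, stub S3♭
`stub_auxiliaryPrimeSupply` — step (F3b-1) of F1–F4 (seat bsd-line-er5-p1-w2 g5). Theorems only,
Mathlib only; nothing here closes 19715.

`not_exists_pow_mul_norm_eq_sq`: let `K` be a number field, `𝔮 ≠ 𝔮'` primes of `𝓞_K` with
`q𝓞_K = 𝔮 𝔮'` (`q` a rational prime SPLIT in `K`), `h ≥ 1` with `[𝔮]^n = 1 ⟹ h ∣ n` in `Cl(𝓞_K)`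
(`h = ord [𝔮]`) and `𝔮^h = (β)`.  Then for an odd prime `p` there is NO `δ ∈ K` with
`δ^p · N(β) = β²` (`N = Algebra.norm ℤ`): i.e. `β² / N(β) = β / β̄` is not a `p`-th power in `K`.
Proof: `|N β| = q^h`; clearing denominators `a^p N(β) = β² b^p` in `𝓞_K` and counting `𝔮'` in the
ideal factorisation gives `p ∣ h`, `h = p h'`; then `ε = a q^{h'}` has `(ε)^p = (β)² (b)^p`, so
`(ε) = 𝔮^{2h'} (b)` and `[𝔮]^{2h'} = 1`, whence `h = p h' ∣ 2h'`, `p ∣ 2` — impossible.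
This is the number-theoretic half of the Kummer exclusion of S3♭ (critic VERDICT #43 (c): the
class-group exclusion); the Galois half (descent from `K(ζ_{p^E}, E[p])` to `K`) is F3b-2.

References: D. A. Cox, *Primes of the form x² + ny²* (2013), §7.B (ideals in quadratic fields)
[Cox2013]; B. H. Gross, LMS LNS 153 (1991), §3 [GrossLMS1991].
-/

noncomputable section

set_option linter.dupNamespace false -- `Summit.BirchSwinnertonDyer.BirchSwinnertonDyer` (summit = problem), tree-wide

open scoped Classical NumberField nonZeroDivisors
open NumberField IsDedekindDomain UniqueFactorizationMonoid

namespace Summit.BirchSwinnertonDyer.BirchSwinnertonDyer.Theorems.AuxPrimeSupply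

variable {K : Type*} [Field K] [NumberField K]

/-! ### Counting a prime in ideal factorisations -/

/-- Count of the prime `𝔭` in `I J` is additive (`I, J ≠ 0`). [folklore] -/
theorem count_normalizedFactors_mul_eq (P : Ideal (𝓞 K)) {I J : Ideal (𝓞 K)} (hI : I ≠ ⊥)
    (hJ : J ≠ ⊥) : (normalizedFactors (I * J)).count P =
      (normalizedFactors I).count P + (normalizedFactors J).count P := by
  rw [normalizedFactors_mul hI hJ, Multiset.count_add]

/-- Count of `𝔭` in `I^n`. [folklore] -/
theorem count_normalizedFactors_pow_eq (P : Ideal (𝓞 K)) (I : Ideal (𝓞 K)) (n : ℕ) :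
    (normalizedFactors (I ^ n)).count P = n * (normalizedFactors I).count P := by
  rw [normalizedFactors_pow, Multiset.count_nsmul]

/-- Count of a prime `𝔭` in a prime `𝔮`: `1` if `𝔮 = 𝔭`, else `0`. [folklore] -/
theorem count_normalizedFactors_prime_eq (P : Ideal (𝓞 K)) (v : HeightOneSpectrum (𝓞 K)) :
    (normalizedFactors v.asIdeal).count P = if v.asIdeal = P then 1 else 0 := by
  rw [normalizedFactors_irreducible v.irreducible, normalize_eq, Multiset.count_singleton]
  simp only [eq_comm]

/-- In the monoid of ideals of `𝓞_K`, `I^n = J^n` with `n ≠ 0` forces `I = J` (unique factorisation,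
trivial units). [folklore] -/
theorem eq_of_pow_eq_pow {I J : Ideal (𝓞 K)} (hI : I ≠ ⊥) (hJ : J ≠ ⊥) {n : ℕ} (hn : n ≠ 0)
    (h : I ^ n = J ^ n) : I = J := by
  have hIn : I ^ n ≠ ⊥ := pow_ne_zero n hI
  have hJn : J ^ n ≠ ⊥ := pow_ne_zero n hJ
  have hnf : normalizedFactors (I ^ n) = normalizedFactors (J ^ n) := by rw [h]
  rw [normalizedFactors_pow, normalizedFactors_pow] at hnf
  have hnf' : normalizedFactors I = normalizedFactors J := by
    refine Multiset.ext.mpr fun P ↦ ?_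
    have := congrArg (Multiset.count P) hnf
    rw [Multiset.count_nsmul, Multiset.count_nsmul] at this
    exact Nat.eq_of_mul_eq_mul_left (Nat.pos_of_ne_zero hn) this
  exact associated_iff_eq.mp ((associated_iff_normalizedFactors_eq_normalizedFactors hI hJ).mpr hnf')

/-! ### The norm of a generator of `𝔮^h` for a split prime `q` -/

/-- If `q𝓞_K = 𝔮 𝔮'` with `𝔮 ≠ 𝔮'` in a quadratic field `K` (`q` a split rational prime) then
`N𝔮 = q`. [cite: Cox2013, §7.B Prop. 7.20 ff. (splitting of primes in quadratic fields)] -/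
theorem absNorm_eq_of_split (h2K : Module.finrank ℚ K = 2) {q : ℕ} (hq : q.Prime)
    {v v' : HeightOneSpectrum (𝓞 K)} (hfac : Ideal.span {(q : 𝓞 K)} = v.asIdeal * v'.asIdeal) :
    Ideal.absNorm v.asIdeal = q := by
  have h := congrArg Ideal.absNorm hfac
  rw [map_mul, Ideal.absNorm_span_singleton] at h
  have hnq : ((Algebra.norm ℤ) (q : 𝓞 K)).natAbs = q ^ 2 := by
    have : Algebra.norm ℤ ((q : ℤ) • (1 : 𝓞 K)) = (q : ℤ) ^ Module.finrank ℚ K := by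
      rw [Algebra.smul_def, mul_one, Algebra.norm_algebraMap, RingOfIntegers.rank]
    rw [zsmul_eq_mul, mul_one, Int.cast_natCast, h2K] at this
    rw [this, Int.natAbs_pow, Int.natAbs_natCast]
  rw [hnq] at h
  have hv1 : 1 < Ideal.absNorm v.asIdeal := NumberField.HeightOneSpectrum.one_lt_absNorm v
  have hv'1 : 1 < Ideal.absNorm v'.asIdeal := NumberField.HeightOneSpectrum.one_lt_absNorm v'
  obtain ⟨i, hi, hvi⟩ := (Nat.dvd_prime_pow hq).mp (Dvd.intro _ h.symm)
  obtain ⟨j, hj, hvj⟩ := (Nat.dvd_prime_pow hq).mp (Dvd.intro_left _ h.symm)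
  rw [hvi, hvj, ← pow_add] at h
  have hij : i + j = 2 := (Nat.pow_right_injective hq.two_le h).symm
  have hi0 : i ≠ 0 := by rintro rfl; rw [pow_zero] at hvi; omega
  have hj0 : j ≠ 0 := by rintro rfl; rw [pow_zero] at hvj; omega
  have hi1 : i = 1 := by omega
  rw [hvi, hi1, pow_one]

/-- `|N(β)| = q^h` when `(β) = 𝔮^h` and `N𝔮 = q`. [cite: Cox2013, §7.B (norms of ideals)] -/
theorem natAbs_norm_eq_of_pow_eq_span {q : ℕ} {v : HeightOneSpectrum (𝓞 K)}
    (hNv : Ideal.absNorm v.asIdeal = q) {h : ℕ} {β : 𝓞 K} (hβ : v.asIdeal ^ h = Ideal.span {β}) :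
    ((Algebra.norm ℤ) β).natAbs = q ^ h := by
  rw [← Ideal.absNorm_span_singleton, ← hβ, map_pow, hNv]

/-! ### The Kummer element is not a `p`-th power in `K` -/

/-- **`β²/N(β)` is not a `p`-th power in `K`.** Let `K` be a quadratic field, `q𝓞_K = 𝔮 𝔮'` with
`𝔮 ≠ 𝔮'`, `h ≥ 1` minimal with `𝔮^h` principal (`[𝔮]^n = 1 ⟹ h ∣ n`), `𝔮^h = (β)`, `p` an odd
prime. Then no `δ ∈ K` satisfies `δ^p · N(β) = β²`. (Counting `𝔮'` in `a^p N(β) = β² b^p`,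
`δ = a/b`, gives `p ∣ h`; then `(a q^{h/p})^p` generates `(β)²(b)^p`, so `𝔮^{2h/p}(b)` is principal
and `h ∣ 2h/p`, i.e. `p ∣ 2`.) [cite: Cox2013, §7.B (unique factorisation of ideals, class group)] -/
theorem not_exists_pow_mul_norm_eq_sq (h2K : Module.finrank ℚ K = 2) {q : ℕ} (hq : q.Prime)
    {v v' : HeightOneSpectrum (𝓞 K)} (hvv' : v ≠ v')
    (hfac : Ideal.span {(q : 𝓞 K)} = v.asIdeal * v'.asIdeal) {h : ℕ} (hh0 : 0 < h)
    (hord : ∀ n : ℕ, ClassGroup.mk0 ⟨v.asIdeal, mem_nonZeroDivisors_iff_ne_zero.mpr v.ne_bot⟩ ^ n = 1 →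
      h ∣ n)
    {β : 𝓞 K} (hβ : v.asIdeal ^ h = Ideal.span {β}) {p : ℕ} (hp : p.Prime) (hp2 : p ≠ 2) :
    ¬ ∃ δ : K, δ ^ p * ((Algebra.norm ℤ β : ℤ) : K) = (algebraMap (𝓞 K) K β) ^ 2 := by
  rintro ⟨δ, hδ⟩
  have hβ0 : β ≠ 0 := by
    intro h0
    refine pow_ne_zero h v.ne_bot ?_
    rw [hβ, h0]
    exact Ideal.span_singleton_eq_bot.mpr rfl
  have hq0 : (q : 𝓞 K) ≠ 0 := by exact_mod_cast hq.ne_zero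
  -- `N(β) = u q^h`, `u = ±1`
  have hNv : Ideal.absNorm v.asIdeal = q := absNorm_eq_of_split h2K hq hfac
  have hNabs := natAbs_norm_eq_of_pow_eq_span hNv hβ
  set N : ℤ := Algebra.norm ℤ β with hNdef
  have hspanN : Ideal.span {(N : 𝓞 K)} = Ideal.span {(q : 𝓞 K)} ^ h := by
    rw [Ideal.span_singleton_pow]
    rcases Int.natAbs_eq_iff.mp hNabs with hN | hN
    · rw [hN]; push_cast; rfl
    · rw [hN]
      push_cast
      exact Ideal.span_singleton_neg _
  -- clear denominators: `δ = a / b`, `a^p N = β² b^p` in `𝓞_K`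
  obtain ⟨a, b, hb, rfl⟩ := IsFractionRing.div_surjective (A := 𝓞 K) δ
  have hb0 : b ≠ 0 := nonZeroDivisors.ne_zero hb
  have hbK : (algebraMap (𝓞 K) K b) ≠ 0 := by
    rw [Ne, RingOfIntegers.coe_eq_zero_iff]; exact hb0
  have heq : a ^ p * (N : 𝓞 K) = β ^ 2 * b ^ p := by
    apply RingOfIntegers.coe_injective (K := K)
    simp only [map_mul, map_pow, map_intCast]
    have h' := hδ
    rw [div_pow, div_mul_eq_mul_div, div_eq_iff (pow_ne_zero _ hbK)] at h'
    linear_combination h'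
  have ha0 : a ≠ 0 := by
    intro h0
    rw [h0, zero_pow hp.ne_zero, zero_mul] at heq
    exact (mul_ne_zero (pow_ne_zero 2 hβ0) (pow_ne_zero p hb0)) heq.symm
  -- the ideal equation `(a)^p (q)^h = (𝔮^h)^2 (b)^p`
  have hI : Ideal.span {a} ^ p * Ideal.span {(q : 𝓞 K)} ^ h =
      (v.asIdeal ^ h) ^ 2 * Ideal.span {b} ^ p := by
    rw [← hspanN, Ideal.span_singleton_pow, Ideal.span_singleton_mul_span_singleton, heq, hβ,
      Ideal.span_singleton_pow, Ideal.span_singleton_pow, Ideal.span_singleton_mul_span_singleton]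
  -- count the prime `𝔮'` on both sides: `p c'(a) + h = p c'(b)`
  have hvne : v.asIdeal ≠ v'.asIdeal := fun h ↦ hvv' (HeightOneSpectrum.ext h)
  have hspa : Ideal.span {a} ≠ ⊥ := by rw [Ne, Ideal.span_singleton_eq_bot]; exact ha0
  have hspb : Ideal.span {b} ≠ ⊥ := by rw [Ne, Ideal.span_singleton_eq_bot]; exact hb0
  have hspq : Ideal.span {(q : 𝓞 K)} ≠ ⊥ := by rw [Ne, Ideal.span_singleton_eq_bot]; exact hq0
  set ca := (normalizedFactors (Ideal.span {a})).count v'.asIdeal with hca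
  set cb := (normalizedFactors (Ideal.span {b})).count v'.asIdeal with hcb
  have hcq : (normalizedFactors (Ideal.span {(q : 𝓞 K)})).count v'.asIdeal = 1 := by
    rw [hfac, count_normalizedFactors_mul_eq _ v.ne_bot v'.ne_bot, count_normalizedFactors_prime_eq,
      count_normalizedFactors_prime_eq, if_neg hvne, if_pos rfl]
  have hcv : (normalizedFactors v.asIdeal).count v'.asIdeal = 0 := by
    rw [count_normalizedFactors_prime_eq, if_neg hvne]
  have hcount : (normalizedFactors (Ideal.span {a} ^ p * Ideal.span {(q : 𝓞 K)} ^ h)).count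
      v'.asIdeal = (normalizedFactors ((v.asIdeal ^ h) ^ 2 * Ideal.span {b} ^ p)).count v'.asIdeal := by
    rw [hI]
  rw [count_normalizedFactors_mul_eq _ (pow_ne_zero p hspa) (pow_ne_zero h hspq),
    count_normalizedFactors_mul_eq _ (pow_ne_zero 2 (pow_ne_zero h v.ne_bot)) (pow_ne_zero p hspb),
    count_normalizedFactors_pow_eq, count_normalizedFactors_pow_eq, count_normalizedFactors_pow_eq,
    count_normalizedFactors_pow_eq, count_normalizedFactors_pow_eq, hcq, hcv, ← hca, ← hcb] at hcount
  -- hcount : p * ca + h * 1 = 2 * (h * 0) + p * cb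
  have hph : p ∣ h := by
    have h1 : h = p * cb - p * ca := by
      set X := p * ca; set Y := p * cb; omega
    rw [h1, ← Nat.mul_sub]
    exact Dvd.intro _ rfl
  obtain ⟨h', rfl⟩ := hph
  have hh' : 0 < h' := Nat.pos_of_mul_pos_left hh0
  -- `ε = a q^{h'}` has `(ε)^p = (𝔮^{2h'} (b))^p`, so `(ε) = 𝔮^{2h'} (b)`
  set ε : 𝓞 K := a * (q : 𝓞 K) ^ h' with hε
  have hεI : Ideal.span {ε} ^ p = (v.asIdeal ^ (2 * h') * Ideal.span {b}) ^ p := by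
    rw [hε, ← Ideal.span_singleton_mul_span_singleton, ← Ideal.span_singleton_pow, mul_pow, ← pow_mul,
      mul_comm h' p, hI, mul_pow, ← pow_mul, ← pow_mul]
    congr 2
    ring
  have hεne : Ideal.span {ε} ≠ ⊥ := by
    rw [Ne, Ideal.span_singleton_eq_bot, hε]
    exact mul_ne_zero ha0 (pow_ne_zero _ hq0)
  have hJne : v.asIdeal ^ (2 * h') * Ideal.span {b} ≠ ⊥ :=
    mul_ne_zero (pow_ne_zero _ v.ne_bot) hspb
  have hεeq : Ideal.span {ε} = v.asIdeal ^ (2 * h') * Ideal.span {b} :=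
    eq_of_pow_eq_pow hεne hJne hp.ne_zero hεI
  -- so `[𝔮]^{2h'} = 1` in the class group
  have hv0 : v.asIdeal ∈ (Ideal (𝓞 K))⁰ := mem_nonZeroDivisors_iff_ne_zero.mpr v.ne_bot
  have hb0' : Ideal.span {b} ∈ (Ideal (𝓞 K))⁰ := mem_nonZeroDivisors_iff_ne_zero.mpr hspb
  have hprincb : ClassGroup.mk0 ⟨Ideal.span {b}, hb0'⟩ = 1 :=
    (ClassGroup.mk0_eq_one_iff hb0').mpr ⟨⟨b, rfl⟩⟩
  have hJ0 : v.asIdeal ^ (2 * h') * Ideal.span {b} ∈ (Ideal (𝓞 K))⁰ :=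
    mem_nonZeroDivisors_iff_ne_zero.mpr hJne
  have hprincJ : ClassGroup.mk0 ⟨v.asIdeal ^ (2 * h') * Ideal.span {b}, hJ0⟩ = 1 := by
    rw [ClassGroup.mk0_eq_one_iff]
    rw [← hεeq]
    exact ⟨⟨ε, rfl⟩⟩
  have hpow : ClassGroup.mk0 ⟨v.asIdeal, hv0⟩ ^ (2 * h') = 1 := by
    have hmul : ClassGroup.mk0 ⟨v.asIdeal ^ (2 * h') * Ideal.span {b}, hJ0⟩ =
        ClassGroup.mk0 ⟨v.asIdeal, hv0⟩ ^ (2 * h') * ClassGroup.mk0 ⟨Ideal.span {b}, hb0'⟩ := by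
      rw [← map_pow, ← map_mul]
      congr 1
    rw [hmul, hprincb, mul_one] at hprincJ
    exact hprincJ
  -- `h = p h' ∣ 2 h'`, so `p ∣ 2`
  have hdvd : p * h' ∣ 2 * h' := hord _ hpow
  have hp2' : p ∣ 2 := Nat.dvd_of_mul_dvd_mul_right hh' hdvd
  exact hp2 ((Nat.prime_dvd_prime_iff_eq hp Nat.prime_two).mp hp2')

end Summit.BirchSwinnertonDyer.BirchSwinnertonDyer.Theorems.AuxPrimeSupply

end
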